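import Summits.QuantumFields.BalabanUV.Beta.D1BFx.PackedTowerSlotsGram
import Summits.QuantumFields.BalabanUV.Beta.D1BFx.TorusMixedLetters

/-!
# BetaPertH road «BF-x» — «COFRAME-PACK-2» P3a: the response-packed SITE words of the twisted mixed weight jet

STATUS: [folklore] torus bookkeeping of the road's (A1)-PACKED identity (BINDER row D1, slot (K), chain step (I)); NOT an estimate of Bałaban's,
NOT a discharge of any root-level binder.  Provenance: reconstruction; the manuscript(s) under audit are NOT citable.

WHAT.  PART 3b's second-order N-side letter `hJN″` reads the twisted mixed co-frame weight jet `tgramMix` at TB4-W jets PACKED by the torus responses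
`rₛ rₜ` of two p-free weight families `wₛ` (centre `Pₛ`), `wₜ` (centre `Pₜ`).  P2 (`PackedCoframePairWords.sum_sum_smul_twgtMix`) multiplied the packed
jet out into nine words in the packed letters `Jw := Σ_i r i • Ljet (e₁ i)`, `Qw := Σ_i r i • (L̂²)_{e₁ i}`, `J₂ := Σ_i rₛ i rₜ i • Ljet₂ (e₁ i)`,
`Q₂ := Σ_{ij} rₛ i rₜ j • (L̂²)_{e₁ i, e₁ j}`, `L̂`, `Ĉ`.  This file gives every SITE word occurring between the outer `D̂`∕`Ê` sandwiches of those nine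
words as `perT s (arr s Z)` of an explicit `ℤ⁴` kernel `Z` (s-dependent only through TA2's `arr s` of an inner packed family and through the periodised
second weight `perW s wₜ`), bi-localised at the weights' centre with a constant that does NOT depend on `s`:
* §1 [our objects] `perW s w` (periodised weight), `gW w := Σ_κ wsum (w κ) ghCur_κ`, `qW w := gW∘(−Δ) + (−Δ)∘gW`, `d2W w ω := Σ_κ wsum (w κ) (u ↦ ω κ u·gh₂ κ u)`,
  `l2W s w w′` (g22's packed pair `L̂²`-family); their localisation (`biLoc_gW`, `biLoc_qW`, `biLoc_d2W`, `biLoc_l2W`).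
* §2 [folklore] the packed torus letters: `sum_smul_Ljet_eq` (`Jw = perT (arr gW)`), `sum_smul_Lsq₁_eq` (`Qw = perT (arr qW)`), `sum_smul_Ljet₂_eq`,
  `sum_sum_smul_Lsq₁₁_eq` (`Q₂ = perT (arr (l2W s wₛ wₜ))`).
* §3 [folklore] the s-UNIFORM localisation (`∃ K, ∀ s, BiLoc Z P P K rate`) of the `ℤ⁴` kernels `Z` of the eight inner site words `L̂ĈJ`, `JĈL̂`,
  `L̂ĈJ₂`, `L̂ĈQĈJ′`, `L̂ĈQĈL̂`, `JĈJ′`, `L̂ĈQ₂ĈL̂`, `L̂ĈQĈQ′ĈL̂` (the torus identities themselves: `PackedCoframeSiteProducts`).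
Unit `b2b-balaban-beta-d1-formalise-leaf-03` (gen 23); road owner `b2b-balaban-beta-d1-p2` (W-d1p2-g18-4∕-5, journal l.40583).
-/

noncomputable section

namespace Summit.QuantumFields.BalabanUV.Beta.D1BFx.PackedCoframeSiteWords

open Matrix Filter Topology
open scoped BigOperators
open Literature.Probability.LatticeModels (TorusSite)
open Literature.MathematicalPhysics.QuantumFieldTheory.Balaban1983to89
open Literature.MathematicalPhysics.QuantumFieldTheory.Balaban1983to89.Beta
open B12Sec2to5 (l1 l1_nonneg)
open ExpKernelCalculus (MKer BiLoc Decays comp shiftK Zl Zl_pos Zl_nonneg biLoc_comp_decays)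
open OneStepResolventKernel (wsum biLoc_wsum)
open KernelWard (biLoc_recentre biLoc_add)
open BalabanStepJetsSucc (biLoc_comp_right decays_comp)
open Summit.QuantumFields.BalabanUV.Beta.TameKernelCalculus (decays_of_le biLoc_of_le)
open Summit.QuantumFields.BalabanUV.Beta.D1BFx.SortedReblocking (torusBlockEquiv)
open Summit.QuantumFields.BalabanUV.Beta.D1BFx.SortedEmbedding (e₁)
open Summit.QuantumFields.BalabanUV.Beta.D1BFx.PeriodicArrays (arr toF decays_arr arr_imageShift)
open Summit.QuantumFields.BalabanUV.Beta.D1BFx.FibredPeriodisation (periodiseF)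
open Summit.QuantumFields.BalabanUV.Beta.D1BFx.TorusCombKKT (I)
open Summit.QuantumFields.BalabanUV.Beta.D1BFx.PeriodisedProjector (Lhat Shat)
open Summit.QuantumFields.BalabanUV.Beta.D1BFx.TorusCoframeJets (Ljet Ljet₂)
open Summit.QuantumFields.BalabanUV.Beta.D1BFx.TorusWeightJetsCombFree (Lsq₁ Lsq₁₁ Chat)
open Summit.QuantumFields.BalabanUV.Beta.D1BFx.GhostStencil (ghCur biLoc_ghCur)
open Summit.QuantumFields.BalabanUV.Beta.D1BFx.KGhostLeg (Cgh)
open Summit.QuantumFields.BalabanUV.Beta.D1BFx.KGhostLegJunction (Chat_eq_submatrix_periodiseF_Cgh)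
open Summit.QuantumFields.BalabanUV.Beta.D1BFx.TorusGhostWordArrays (perT lapU decays_lapU lapU_imageShift Lhat_eq_perT perT_add perT_mul_perT_arr
  perT_arr_mul_perT summable_row_arr)
open Summit.QuantumFields.BalabanUV.Beta.D1BFx.TorusGhostPairStencils (gh₂ biLoc_gh₂ perT_arr_mul_perT_arr)
open Summit.QuantumFields.BalabanUV.Beta.D1BFx.TorusBondArrays (dB dB_pos dB_le_one decays_lapU_Cgh decays_Cgh_lapU lapU_Cgh_imageShift
  Cgh_lapU_imageShift Lhat_mul_perT_Cgh perT_Cgh_mul_Lhat)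
open Summit.QuantumFields.BalabanUV.Beta.D1BFx.TorusMixedLetters (decays_Cgh_dB)
open Summit.QuantumFields.BalabanUV.Beta.D1BFx.TorusTwoArrayWords (biLoc_comp_arr)
open Summit.QuantumFields.BalabanUV.Beta.D1BFx.PeriodicArrayPackingPlain (biLoc_dirsum_wsum biLoc_dirsum_wsum_per)
open Summit.QuantumFields.BalabanUV.Beta.D1BFx.PackedTowerSlotsGram (ghCur_imageShift gh₂_imageShift sum_smul_Ljet sum_smul_Ljet₂ sum_sum_smul_Lsq₁₁_eq_perT)

/-! ## §1 The packed site kernels and their localisation -/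

section Kernels

/-- [our object] **THE PERIODISED WEIGHT** `perW s w κ u := Σ'_t w κ (u + s·t)` (the torus response read at window representatives). A definition. -/
def perW (s : ℕ) (w : Fin 4 → (Fin 4 → ℤ) → ℝ) : Fin 4 → (Fin 4 → ℤ) → ℝ := fun κ u => ∑' t : Fin 4 → ℤ, w κ (imageShift s u t)

/-- [our object] **THE PACKED GHOST CURRENT** `gW w := Σ_κ wsum (w κ) ghCur_κ` (the table of `Jw = Σ_i r i • Ljet (e₁ i)`). A definition. -/
def gW (w : Fin 4 → (Fin 4 → ℤ) → ℝ) : MKer 4 Unit := fun x y a b => ∑ κ : Fin 4, wsum (w κ) (ghCur κ) x y a b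

/-- [our object] **THE PACKED `L̂²`-WORD** `qW w := gW w ∘ (−Δ) + (−Δ) ∘ gW w` (the table of `Qw = Σ_i r i • (L̂²)_{e₁ i}`). A definition. -/
def qW (w : Fin 4 → (Fin 4 → ℤ) → ℝ) : MKer 4 Unit := comp (gW w) lapU + comp lapU (gW w)

/-- [our object] **THE PACKED DIAGONAL PAIR TABLE** `d2W w ω := Σ_κ wsum (w κ) (u ↦ ω κ u · gh₂ κ u)` (the table of `J₂ = Σ_i r i r′ i • Ljet₂ (e₁ i)` when
`ω = perW s w′`; its `s → ∞` limit when `ω = w′`). A definition. -/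
def d2W (w ω : Fin 4 → (Fin 4 → ℤ) → ℝ) : MKer 4 Unit :=
  fun x y a b => ∑ κ : Fin 4, wsum (w κ) (fun u => fun x y a b => ω κ u * gh₂ κ u x y a b) x y a b

/-- [our object] **THE PACKED `L̂²`-PAIR TABLE** (g22's `ℒ₂ˢ` in PRODUCT form):
`l2W s w w′ := d2W w (perW s w′) ∘ (−Δ) + gW w ∘ arr s (gW w′) + gW w′ ∘ arr s (gW w) + (−Δ) ∘ d2W w (perW s w′)`. A definition. -/
def l2W (s : ℕ) (w w' : Fin 4 → (Fin 4 → ℤ) → ℝ) : MKer 4 Unit :=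
  comp (d2W w (perW s w')) lapU + comp (gW w) (arr s (gW w')) + comp (gW w') (arr s (gW w)) + comp lapU (d2W w (perW s w'))

variable {w w' : Fin 4 → (Fin 4 → ℤ) → ℝ} {C C' δ : ℝ} {P P' : Fin 4 → ℤ}

/-- [folklore] `BiLoc (gW w) P P (4·C·e^δ·Zl(δ∕2)) (δ∕2)` (FILE 1 `biLoc_dirsum_wsum` at the ghost current). -/
theorem biLoc_gW (hw : ∀ κ u, |w κ u| ≤ C * Real.exp (-δ * l1 (u - P))) (hδ : 0 < δ) :
    BiLoc (gW w) P P (∑ _κ : Fin (3 + 1), C * Real.exp δ * Zl (3 + 1) (δ / 2)) (δ / 2) :=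
  biLoc_dirsum_wsum (d := 3) hw (fun κ u => biLoc_ghCur κ u δ) hδ (PeriodicArrayWrapLimit.const_nonneg_of_weight (hw 0))

/-- [folklore] `BiLoc (qW w) P P _ (δ∕4)` for `0 < δ ≤ 1`. -/
theorem biLoc_qW (hw : ∀ κ u, |w κ u| ≤ C * Real.exp (-δ * l1 (u - P))) (hδ : 0 < δ) (hδ1 : δ ≤ 1) :
    BiLoc (qW w) P P
      ((Fintype.card Unit : ℝ) * ((∑ _κ : Fin (3 + 1), C * Real.exp δ * Zl (3 + 1) (δ / 2)) * |16 * Real.exp 1|) * Zl 4 (δ / 2 - δ / 4)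
        + (Fintype.card Unit : ℝ) * (|16 * Real.exp 1| * (∑ _κ : Fin (3 + 1), C * Real.exp δ * Zl (3 + 1) (δ / 2))) * Zl 4 (δ / 2 - δ / 4))
      (δ / 4) := by
  have hG := biLoc_gW hw hδ
  have hL : Decays lapU (|16 * Real.exp 1|) (δ / 2) := decays_of_le decays_lapU (by linarith)
  exact biLoc_add (biLoc_comp_right hG hL (by linarith) (by linarith)) (biLoc_comp_decays hL hG (by linarith) (by linarith))

/-- [folklore] `BiLoc (d2W w (perW s w′)) P P _ (δ∕2)` with an `s`-FREE constant (FILE 1 `biLoc_dirsum_wsum_per`). -/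
theorem biLoc_d2W_perW (hw : ∀ κ u, |w κ u| ≤ C * Real.exp (-δ * l1 (u - P))) (hw' : ∀ κ u, |w' κ u| ≤ C' * Real.exp (-δ * l1 (u - P')))
    (hδ : 0 < δ) (s : ℕ) [NeZero s] :
    BiLoc (d2W w (perW s w')) P P (∑ _κ : Fin (3 + 1), C * (C' * Zl (3 + 1) δ * (Real.exp δ + Real.exp δ)) * Zl (3 + 1) (δ / 2)) (δ / 2) :=
  biLoc_dirsum_wsum_per (d := 3) hw hw' (fun κ u => biLoc_gh₂ κ u δ) hδ (PeriodicArrayWrapLimit.const_nonneg_of_weight (hw 0)) s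

/-- [folklore] `BiLoc (d2W w w′) P P _ (δ∕2)` (the limit table; FILE 1 `biLoc_dirsum_wsum_mul`). -/
theorem biLoc_d2W (hw : ∀ κ u, |w κ u| ≤ C * Real.exp (-δ * l1 (u - P))) (hw' : ∀ κ u, |w' κ u| ≤ C' * Real.exp (-δ * l1 (u - P')))
    (hδ : 0 < δ) :
    BiLoc (d2W w w') P P (∑ _κ : Fin (3 + 1), C * (C' * (Real.exp δ + Real.exp δ)) * Zl (3 + 1) (δ / 2)) (δ / 2) :=
  PeriodicArrayPackingPlain.biLoc_dirsum_wsum_mul (d := 3) hw hw' (fun κ u => biLoc_gh₂ κ u δ) hδ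
    (PeriodicArrayWrapLimit.const_nonneg_of_weight (hw 0))

/-- [folklore] **s-UNIFORM LOCALISATION OF THE PACKED `L̂²`-PAIR TABLE** at `(P, P)`, rate `δ∕8` (`0 < δ ≤ 1`; the constant depends on `|P − P′|₁`). -/
theorem biLoc_l2W (hw : ∀ κ u, |w κ u| ≤ C * Real.exp (-δ * l1 (u - P))) (hw' : ∀ κ u, |w' κ u| ≤ C' * Real.exp (-δ * l1 (u - P')))
    (hδ : 0 < δ) (hδ1 : δ ≤ 1) :
    ∃ K : ℝ, 0 ≤ K ∧ ∀ (s : ℕ) [NeZero s], BiLoc (l2W s w w') P P K (δ / 8) := by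
  have hCw : 0 ≤ C := PeriodicArrayWrapLimit.const_nonneg_of_weight (hw 0)
  have hG := biLoc_gW hw hδ
  have hG' := biLoc_gW hw' hδ
  have hL : Decays lapU (|16 * Real.exp 1|) (δ / 2) := decays_of_le decays_lapU (by linarith)
  -- the four pieces, each at rate `δ/8` and centre `(P,P)`
  have h1 : ∀ (s : ℕ) [NeZero s], BiLoc (comp (d2W w (perW s w')) lapU) P P
      (|((Fintype.card Unit : ℝ) * ((∑ _κ : Fin (3 + 1), C * (C' * Zl (3 + 1) δ * (Real.exp δ + Real.exp δ)) * Zl (3 + 1) (δ / 2)) * |16 * Real.exp 1|)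
        * Zl 4 (δ / 2 - δ / 4))|) (δ / 8) :=
    fun s _ => biLoc_of_le (biLoc_comp_right (biLoc_d2W_perW hw hw' hδ s) hL (by linarith) (by linarith)) (by linarith)
  have h4 : ∀ (s : ℕ) [NeZero s], BiLoc (comp lapU (d2W w (perW s w'))) P P
      (|((Fintype.card Unit : ℝ) * (|16 * Real.exp 1| * (∑ _κ : Fin (3 + 1), C * (C' * Zl (3 + 1) δ * (Real.exp δ + Real.exp δ)) * Zl (3 + 1) (δ / 2)))
        * Zl 4 (δ / 2 - δ / 4))|) (δ / 8) :=
    fun s _ => biLoc_of_le (biLoc_comp_decays hL (biLoc_d2W_perW hw hw' hδ s) (by linarith) (by linarith)) (by linarith)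
  have h2 : ∀ (s : ℕ) [NeZero s], BiLoc (comp (gW w) (arr s (gW w'))) P P _ (δ / 2 / 4) := fun s _ => biLoc_comp_arr s hG hG' (half_pos hδ)
  have h3 : ∀ (s : ℕ) [NeZero s], BiLoc (comp (gW w') (arr s (gW w))) P P _ (δ / 2 / 4) := fun s _ =>
    biLoc_recentre (biLoc_comp_arr s hG' hG (half_pos hδ)) (by linarith) P P
  obtain ⟨K2, hK2⟩ : ∃ K2 : ℝ, ∀ (s : ℕ) [NeZero s], BiLoc (comp (gW w) (arr s (gW w'))) P P K2 (δ / 8) :=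
    ⟨_, fun s _ => by have h := h2 s; rwa [show δ / 2 / 4 = δ / 8 by ring] at h⟩
  obtain ⟨K3, hK3⟩ : ∃ K3 : ℝ, ∀ (s : ℕ) [NeZero s], BiLoc (comp (gW w') (arr s (gW w))) P P K3 (δ / 8) :=
    ⟨_, fun s _ => by have h := h3 s; rwa [show δ / 2 / 4 = δ / 8 by ring] at h⟩
  refine ⟨_, ?_, fun s _ => biLoc_add (biLoc_add (biLoc_add (h1 s) (hK2 s)) (hK3 s)) (h4 s)⟩
  have := (hK2 1).nonneg ()
  have := (hK3 1).nonneg ()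
  positivity

end Kernels

/-! ## §2 The packed torus letters -/

section Letters

variable {m : ℕ} (p : ℕ) [NeZero p] {w w' : Fin 4 → (Fin 4 → ℤ) → ℝ} {C C' δ : ℝ} {P P' : Fin 4 → ℤ} {r r' : I 3 (m + 1) p → ℝ}

/-- [folklore] **`Jw = perT (arr (gW w))`** (g22 `sum_smul_Ljet`). -/
theorem sum_smul_Ljet_eq (hw : ∀ κ u, |w κ u| ≤ C * Real.exp (-δ * l1 (u - P))) (hδ : 0 < δ)
    (hr : ∀ k, r k = ∑' t : Fin 4 → ℤ, w k.2.2 (imageShift ((m + 1) * p) (windowMap 4 ((m + 1) * p) (torusBlockEquiv (m + 1) p (k.1, k.2.1))) t)) :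
    ∑ k : I 3 (m + 1) p, r k • Ljet ((m + 1) * p) (e₁ (m + 1) p k) = perT ((m + 1) * p) (arr ((m + 1) * p) (gW w)) :=
  sum_smul_Ljet p hw hδ hr

/-- [folklore] **`Qw = perT (arr (qW w))`**: `Σ_k r k • (L̂²)_{e₁ k} = Jw·L̂ + L̂·Jw` and the two leg products (`0 < δ ≤ 1`). -/
theorem sum_smul_Lsq₁_eq (hw : ∀ κ u, |w κ u| ≤ C * Real.exp (-δ * l1 (u - P))) (hδ : 0 < δ) (hδ1 : δ ≤ 1)
    (hr : ∀ k, r k = ∑' t : Fin 4 → ℤ, w k.2.2 (imageShift ((m + 1) * p) (windowMap 4 ((m + 1) * p) (torusBlockEquiv (m + 1) p (k.1, k.2.1))) t)) :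
    ∑ k : I 3 (m + 1) p, r k • Lsq₁ ((m + 1) * p) (e₁ (m + 1) p k) = perT ((m + 1) * p) (arr ((m + 1) * p) (qW w)) := by
  have hG := biLoc_gW hw hδ
  have hδ2 := half_pos hδ
  have e : ∑ k : I 3 (m + 1) p, r k • Lsq₁ ((m + 1) * p) (e₁ (m + 1) p k)
      = (∑ k : I 3 (m + 1) p, r k • Ljet ((m + 1) * p) (e₁ (m + 1) p k)) * Lhat ((m + 1) * p)
        + Lhat ((m + 1) * p) * (∑ k : I 3 (m + 1) p, r k • Ljet ((m + 1) * p) (e₁ (m + 1) p k)) := by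
    simp only [Lsq₁, smul_add, Finset.sum_add_distrib, Matrix.sum_mul, Matrix.smul_mul, Matrix.mul_sum, Matrix.mul_smul]
  rw [e, sum_smul_Ljet_eq p hw hδ hr, Lhat_eq_perT,
    perT_arr_mul_perT _ decays_lapU one_pos (fun x y t a b => lapU_imageShift _ x y t a b) hG hδ2,
    perT_mul_perT_arr _ decays_lapU one_pos (fun x y t a b => lapU_imageShift _ x y t a b) hG hδ2, qW,
    ← perT_add _ (summable_row_arr _ (biLoc_comp_right hG (decays_of_le decays_lapU (by linarith : δ / 2 ≤ 1)) (by linarith)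
        (by linarith : δ / 4 < δ / 2)) (by linarith))
      (summable_row_arr _ (biLoc_comp_decays (decays_of_le decays_lapU (by linarith : δ / 2 ≤ 1)) hG (by linarith)
        (by linarith : δ / 4 < δ / 2)) (by linarith))]
  rw [TorusGhostWordArrays.arr_add _ (biLoc_comp_right hG (decays_of_le decays_lapU (by linarith : δ / 2 ≤ 1)) (by linarith)
        (by linarith : δ / 4 < δ / 2)) (by linarith : (0 : ℝ) < δ / 4)
      (biLoc_comp_decays (decays_of_le decays_lapU (by linarith : δ / 2 ≤ 1)) hG (by linarith) (by linarith : δ / 4 < δ / 2)) (by linarith)]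

/-- [folklore] **`J₂ = perT (arr (d2W w (perW s w′)))`** (g22 `sum_smul_Ljet₂`). -/
theorem sum_smul_Ljet₂_eq (hw : ∀ κ u, |w κ u| ≤ C * Real.exp (-δ * l1 (u - P))) (hw' : ∀ κ u, |w' κ u| ≤ C' * Real.exp (-δ * l1 (u - P')))
    (hδ : 0 < δ)
    (hr : ∀ k, r k = ∑' t : Fin 4 → ℤ, w k.2.2 (imageShift ((m + 1) * p) (windowMap 4 ((m + 1) * p) (torusBlockEquiv (m + 1) p (k.1, k.2.1))) t))
    (hr' : ∀ k, r' k = ∑' t : Fin 4 → ℤ, w' k.2.2 (imageShift ((m + 1) * p) (windowMap 4 ((m + 1) * p) (torusBlockEquiv (m + 1) p (k.1, k.2.1))) t)) :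
    ∑ k : I 3 (m + 1) p, (r k * r' k) • Ljet₂ ((m + 1) * p) (e₁ (m + 1) p k) = perT ((m + 1) * p) (arr ((m + 1) * p) (d2W w (perW ((m + 1) * p) w'))) :=
  sum_smul_Ljet₂ p hw hw' hδ hr hr'

/-- [folklore] **`Q₂ = perT (arr (l2W s w w′))`** (g22 `sum_sum_smul_Lsq₁₁_eq_perT`, `0 < δ ≤ ½`). -/
theorem sum_sum_smul_Lsq₁₁_eq (hw : ∀ κ u, |w κ u| ≤ C * Real.exp (-δ * l1 (u - P))) (hw' : ∀ κ u, |w' κ u| ≤ C' * Real.exp (-δ * l1 (u - P')))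
    (hδ : 0 < δ) (hδ1 : δ ≤ 1 / 2)
    (hr : ∀ k, r k = ∑' t : Fin 4 → ℤ, w k.2.2 (imageShift ((m + 1) * p) (windowMap 4 ((m + 1) * p) (torusBlockEquiv (m + 1) p (k.1, k.2.1))) t))
    (hr' : ∀ k, r' k = ∑' t : Fin 4 → ℤ, w' k.2.2 (imageShift ((m + 1) * p) (windowMap 4 ((m + 1) * p) (torusBlockEquiv (m + 1) p (k.1, k.2.1))) t)) :
    ∑ k : I 3 (m + 1) p, ∑ l : I 3 (m + 1) p, (r k * r' l) • Lsq₁₁ ((m + 1) * p) (e₁ (m + 1) p k) (e₁ (m + 1) p l)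
      = perT ((m + 1) * p) (arr ((m + 1) * p) (l2W ((m + 1) * p) w w')) :=
  sum_sum_smul_Lsq₁₁_eq_perT p w w' hw hw' hδ hδ1 r r' hr hr'

end Letters

/-! ## §3 The `ℤ⁴` kernels of the inner site words: s-uniform localisation -/

section Words

variable (m : ℕ) {a : ℝ} (p : ℕ) [NeZero p] {ρ : Type*} [Fintype ρ] [DecidableEq ρ] {N : Matrix (Site 4 ((m + 1) * p)) ρ ℝ}
  {w w' : Fin 4 → (Fin 4 → ℤ) → ℝ} {C C' δ : ℝ} {P P' : Fin 4 → ℤ} {r r' : I 3 (m + 1) p → ℝ}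

omit [NeZero p] in
/-- [folklore] `δ ≤ dB/8` puts `δ` below `1`, below `½` and below the legs' rate `dB/2`. -/
theorem rate_aux (ha : 0 < a) (hδ : 0 < δ) (hδB : δ ≤ dB (m + 1) a / 8) :
    δ ≤ 1 ∧ δ ≤ 1 / 2 ∧ δ / 2 ≤ dB (m + 1) a / 2 ∧ 0 < dB (m + 1) a := by
  have h1 := dB_le_one (m + 1) a
  have h2 := dB_pos (m + 1) a ha
  exact ⟨by linarith, by linarith, by linarith, h2⟩

/-- [folklore] `BiLoc ((lapU∘Cgh) ∘ gW w) P P K (δ∕4)`. -/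
theorem biLoc_LC_gW (ha : 0 < a) (hw : ∀ κ u, |w κ u| ≤ C * Real.exp (-δ * l1 (u - P))) (hδ : 0 < δ) (hδB : δ ≤ dB (m + 1) a / 8) :
    ∃ K : ℝ, 0 ≤ K ∧ BiLoc (comp (comp lapU (Cgh (m + 1) a)) (gW w)) P P K (δ / 4) := by
  obtain ⟨h1, -, h3, -⟩ := rate_aux m ha hδ hδB
  obtain ⟨CA, hA⟩ := decays_lapU_Cgh (m + 1) a ha
  have h := biLoc_comp_decays (decays_of_le hA h3) (biLoc_gW hw hδ) (by linarith : 0 ≤ δ / 4) (by linarith)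
  exact ⟨_, h.nonneg (), h⟩

/-- [folklore] `BiLoc (gW w ∘ (Cgh∘lapU)) P P K (δ∕4)`. -/
theorem biLoc_gW_CL (ha : 0 < a) (hw : ∀ κ u, |w κ u| ≤ C * Real.exp (-δ * l1 (u - P))) (hδ : 0 < δ) (hδB : δ ≤ dB (m + 1) a / 8) :
    ∃ K : ℝ, 0 ≤ K ∧ BiLoc (comp (gW w) (comp (Cgh (m + 1) a) lapU)) P P K (δ / 4) := by
  obtain ⟨h1, -, h3, -⟩ := rate_aux m ha hδ hδB
  obtain ⟨CA, hA⟩ := decays_Cgh_lapU (m + 1) a ha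
  have h := biLoc_comp_right (biLoc_gW hw hδ) (decays_of_le hA h3) (by linarith : 0 ≤ δ / 4) (by linarith)
  exact ⟨_, h.nonneg (), h⟩

/-- [folklore] `BiLoc (gW w ∘ Cgh) P P K (δ∕4)`. -/
theorem biLoc_gW_Cgh (ha : 0 < a) (hw : ∀ κ u, |w κ u| ≤ C * Real.exp (-δ * l1 (u - P))) (hδ : 0 < δ) (hδB : δ ≤ dB (m + 1) a / 8) :
    ∃ K : ℝ, 0 ≤ K ∧ BiLoc (comp (gW w) (Cgh (m + 1) a)) P P K (δ / 4) := by
  obtain ⟨h1, -, h3, -⟩ := rate_aux m ha hδ hδB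
  obtain ⟨CA, hA⟩ := decays_Cgh_dB m ha
  have h := biLoc_comp_right (biLoc_gW hw hδ) (decays_of_le hA h3) (by linarith : 0 ≤ δ / 4) (by linarith)
  exact ⟨_, h.nonneg (), h⟩

/-- [folklore] `BiLoc ((lapU∘Cgh) ∘ d2W w (perW s w′)) P P K (δ∕4)`, one `K` for every `s`. -/
theorem biLoc_LC_d2W (ha : 0 < a) (hw : ∀ κ u, |w κ u| ≤ C * Real.exp (-δ * l1 (u - P)))
    (hw' : ∀ κ u, |w' κ u| ≤ C' * Real.exp (-δ * l1 (u - P'))) (hδ : 0 < δ) (hδB : δ ≤ dB (m + 1) a / 8) :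
    ∃ K : ℝ, 0 ≤ K ∧ ∀ (s : ℕ) [NeZero s], BiLoc (comp (comp lapU (Cgh (m + 1) a)) (d2W w (perW s w'))) P P K (δ / 4) := by
  obtain ⟨h1, -, h3, -⟩ := rate_aux m ha hδ hδB
  obtain ⟨CA, hA⟩ := decays_lapU_Cgh (m + 1) a ha
  have h : ∀ (s : ℕ) [NeZero s], BiLoc (comp (comp lapU (Cgh (m + 1) a)) (d2W w (perW s w'))) P P _ (δ / 4) := fun s _ =>
    biLoc_comp_decays (decays_of_le hA h3) (biLoc_d2W_perW hw hw' hδ s) (by linarith : 0 ≤ δ / 4) (by linarith)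
  exact ⟨_, (h 1).nonneg (), fun s _ => h s⟩

/-- [folklore] `BiLoc ((lapU∘Cgh) ∘ qW w) P P K (δ∕8)`. -/
theorem biLoc_LC_qW (ha : 0 < a) (hw : ∀ κ u, |w κ u| ≤ C * Real.exp (-δ * l1 (u - P))) (hδ : 0 < δ) (hδB : δ ≤ dB (m + 1) a / 8) :
    ∃ K : ℝ, 0 ≤ K ∧ BiLoc (comp (comp lapU (Cgh (m + 1) a)) (qW w)) P P K (δ / 8) := by
  obtain ⟨h1, -, h3, -⟩ := rate_aux m ha hδ hδB
  obtain ⟨CA, hA⟩ := decays_lapU_Cgh (m + 1) a ha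
  have h := biLoc_comp_decays (decays_of_le hA (by linarith : δ / 4 ≤ dB (m + 1) a / 2)) (biLoc_qW hw hδ h1) (by linarith : 0 ≤ δ / 8)
    (by linarith)
  exact ⟨_, h.nonneg (), h⟩

/-- [folklore] `BiLoc (((lapU∘Cgh) ∘ qW w) ∘ (Cgh∘lapU)) P P K (δ∕16)`. -/
theorem biLoc_LC_qW_CL (ha : 0 < a) (hw : ∀ κ u, |w κ u| ≤ C * Real.exp (-δ * l1 (u - P))) (hδ : 0 < δ) (hδB : δ ≤ dB (m + 1) a / 8) :
    ∃ K : ℝ, 0 ≤ K ∧ BiLoc (comp (comp (comp lapU (Cgh (m + 1) a)) (qW w)) (comp (Cgh (m + 1) a) lapU)) P P K (δ / 16) := by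
  obtain ⟨h1, -, h3, -⟩ := rate_aux m ha hδ hδB
  obtain ⟨K₁, -, hK₁⟩ := biLoc_LC_qW m ha hw hδ hδB
  obtain ⟨CA, hA⟩ := decays_Cgh_lapU (m + 1) a ha
  have h := biLoc_comp_right hK₁ (decays_of_le hA (by linarith : δ / 8 ≤ dB (m + 1) a / 2)) (by linarith : 0 ≤ δ / 16) (by linarith)
  exact ⟨_, h.nonneg (), h⟩

/-- [folklore] `BiLoc (((lapU∘Cgh) ∘ qW w) ∘ Cgh) P P K (δ∕16)`. -/
theorem biLoc_LC_qW_Cgh (ha : 0 < a) (hw : ∀ κ u, |w κ u| ≤ C * Real.exp (-δ * l1 (u - P))) (hδ : 0 < δ) (hδB : δ ≤ dB (m + 1) a / 8) :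
    ∃ K : ℝ, 0 ≤ K ∧ BiLoc (comp (comp (comp lapU (Cgh (m + 1) a)) (qW w)) (Cgh (m + 1) a)) P P K (δ / 16) := by
  obtain ⟨h1, -, h3, -⟩ := rate_aux m ha hδ hδB
  obtain ⟨K₁, -, hK₁⟩ := biLoc_LC_qW m ha hw hδ hδB
  obtain ⟨CA, hA⟩ := decays_Cgh_dB m ha
  have h := biLoc_comp_right hK₁ (decays_of_le hA (by linarith : δ / 8 ≤ dB (m + 1) a / 2)) (by linarith : 0 ≤ δ / 16) (by linarith)
  exact ⟨_, h.nonneg (), h⟩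

/-- [folklore] `BiLoc ((((lapU∘Cgh) ∘ qW w) ∘ Cgh) ∘ arr s (gW w′)) P P K (δ∕64)`, one `K` for every `s`. -/
theorem biLoc_LC_qW_Cgh_arr_gW (ha : 0 < a) (hw : ∀ κ u, |w κ u| ≤ C * Real.exp (-δ * l1 (u - P)))
    (hw' : ∀ κ u, |w' κ u| ≤ C' * Real.exp (-δ * l1 (u - P'))) (hδ : 0 < δ) (hδB : δ ≤ dB (m + 1) a / 8) :
    ∃ K : ℝ, 0 ≤ K ∧ ∀ (s : ℕ) [NeZero s],
      BiLoc (comp (comp (comp (comp lapU (Cgh (m + 1) a)) (qW w)) (Cgh (m + 1) a)) (arr s (gW w'))) P P K (δ / 64) := by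
  obtain ⟨K₁, hK₁0, hK₁⟩ := biLoc_LC_qW_Cgh m ha hw hδ hδB
  have hG' := StepJetData.biLoc_weaken (biLoc_gW hw' hδ) le_rfl (by linarith : δ / 16 ≤ δ / 2)
  have h : ∀ (s : ℕ) [NeZero s], BiLoc (comp (comp (comp (comp lapU (Cgh (m + 1) a)) (qW w)) (Cgh (m + 1) a)) (arr s (gW w'))) P P _
      (δ / 16 / 4) := fun s _ => biLoc_comp_arr s hK₁ hG' (by linarith)
  exact ⟨_, (h 1).nonneg (), fun s _ => StepJetData.biLoc_weaken (h s) le_rfl (by linarith)⟩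

/-- [folklore] `BiLoc ((gW w ∘ Cgh) ∘ arr s (gW w′)) P P K (δ∕16)`, one `K` for every `s`. -/
theorem biLoc_gW_Cgh_arr_gW (ha : 0 < a) (hw : ∀ κ u, |w κ u| ≤ C * Real.exp (-δ * l1 (u - P)))
    (hw' : ∀ κ u, |w' κ u| ≤ C' * Real.exp (-δ * l1 (u - P'))) (hδ : 0 < δ) (hδB : δ ≤ dB (m + 1) a / 8) :
    ∃ K : ℝ, 0 ≤ K ∧ ∀ (s : ℕ) [NeZero s], BiLoc (comp (comp (gW w) (Cgh (m + 1) a)) (arr s (gW w'))) P P K (δ / 16) := by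
  obtain ⟨K₁, hK₁0, hK₁⟩ := biLoc_gW_Cgh m ha hw hδ hδB
  have hG' := StepJetData.biLoc_weaken (biLoc_gW hw' hδ) le_rfl (by linarith : δ / 4 ≤ δ / 2)
  have h : ∀ (s : ℕ) [NeZero s], BiLoc (comp (comp (gW w) (Cgh (m + 1) a)) (arr s (gW w'))) P P _ (δ / 4 / 4) := fun s _ =>
    biLoc_comp_arr s hK₁ hG' (by linarith)
  exact ⟨_, (h 1).nonneg (), fun s _ => StepJetData.biLoc_weaken (h s) le_rfl (by linarith)⟩

/-- [folklore] `BiLoc (((lapU∘Cgh) ∘ l2W s w w′) ∘ (Cgh∘lapU)) P P K (δ∕32)`, one `K` for every `s`. -/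
theorem biLoc_LC_l2W_CL (ha : 0 < a) (hw : ∀ κ u, |w κ u| ≤ C * Real.exp (-δ * l1 (u - P)))
    (hw' : ∀ κ u, |w' κ u| ≤ C' * Real.exp (-δ * l1 (u - P'))) (hδ : 0 < δ) (hδB : δ ≤ dB (m + 1) a / 8) :
    ∃ K : ℝ, 0 ≤ K ∧ ∀ (s : ℕ) [NeZero s],
      BiLoc (comp (comp (comp lapU (Cgh (m + 1) a)) (l2W s w w')) (comp (Cgh (m + 1) a) lapU)) P P K (δ / 32) := by
  obtain ⟨h1, -, h3, -⟩ := rate_aux m ha hδ hδB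
  obtain ⟨K₁, -, hK₁⟩ := biLoc_l2W hw hw' hδ h1
  obtain ⟨CA, hA⟩ := decays_lapU_Cgh (m + 1) a ha
  obtain ⟨CB, hB⟩ := decays_Cgh_lapU (m + 1) a ha
  have h : ∀ (s : ℕ) [NeZero s], BiLoc (comp (comp (comp lapU (Cgh (m + 1) a)) (l2W s w w')) (comp (Cgh (m + 1) a) lapU)) P P _ (δ / 32) :=
    fun s _ => biLoc_comp_right (biLoc_comp_decays (decays_of_le hA (by linarith : δ / 8 ≤ dB (m + 1) a / 2)) (hK₁ s) (by linarith : 0 ≤ δ / 16)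
      (by linarith)) (decays_of_le hB (by linarith : δ / 16 ≤ dB (m + 1) a / 2)) (by linarith : 0 ≤ δ / 32) (by linarith)
  exact ⟨_, (h 1).nonneg (), fun s _ => h s⟩

/-- [folklore] `BiLoc (((((lapU∘Cgh) ∘ qW w) ∘ Cgh) ∘ arr s (qW w′)) ∘ (Cgh∘lapU)) P P K (δ∕128)`, one `K` for every `s`. -/
theorem biLoc_LC_qW_Cgh_arr_qW_CL (ha : 0 < a) (hw : ∀ κ u, |w κ u| ≤ C * Real.exp (-δ * l1 (u - P)))
    (hw' : ∀ κ u, |w' κ u| ≤ C' * Real.exp (-δ * l1 (u - P'))) (hδ : 0 < δ) (hδB : δ ≤ dB (m + 1) a / 8) :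
    ∃ K : ℝ, 0 ≤ K ∧ ∀ (s : ℕ) [NeZero s],
      BiLoc (comp (comp (comp (comp (comp lapU (Cgh (m + 1) a)) (qW w)) (Cgh (m + 1) a)) (arr s (qW w'))) (comp (Cgh (m + 1) a) lapU))
        P P K (δ / 128) := by
  obtain ⟨h1, -, h3, -⟩ := rate_aux m ha hδ hδB
  obtain ⟨K₁, hK₁0, hK₁⟩ := biLoc_LC_qW_Cgh m ha hw hδ hδB
  obtain ⟨CB, hB⟩ := decays_Cgh_lapU (m + 1) a ha
  have hq' := StepJetData.biLoc_weaken (biLoc_qW hw' hδ h1) le_rfl (by linarith : δ / 16 ≤ δ / 4)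
  have h : ∀ (s : ℕ) [NeZero s],
      BiLoc (comp (comp (comp (comp (comp lapU (Cgh (m + 1) a)) (qW w)) (Cgh (m + 1) a)) (arr s (qW w'))) (comp (Cgh (m + 1) a) lapU)) P P _
        (δ / 16 / 4 / 2) := fun s _ =>
    biLoc_comp_right (biLoc_comp_arr s hK₁ hq' (by linarith)) (decays_of_le hB (by linarith : δ / 16 / 4 ≤ dB (m + 1) a / 2))
      (by linarith : 0 ≤ δ / 16 / 4 / 2) (by linarith)
  exact ⟨_, (h 1).nonneg (), fun s _ => StepJetData.biLoc_weaken (h s) le_rfl (by linarith)⟩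

end Words

end Summit.QuantumFields.BalabanUV.Beta.D1BFx.PackedCoframeSiteWords

end
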